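import Summits.AtomisticToContinuum.Crystallization.Theorems.FreeSplittingCertificatesStrictSplittingRuleDefs
import Summits.AtomisticToContinuum.Crystallization.Theorems.FreeSplittingCertificatesStrictSplittingRulePerturbativeReduction

/-!
# `StrictSplittingRule` (stmt-AtomisticToContinuum-12560), line `polytype`: vocabulary and the three-class reduction

Route `FreeSplittingCertificates`, crux r3 `StrictSplittingRule`.  The route-level split "polytype selection is
perturbative" (crux-strategist, glue `stub_closePackingGlue` landed in `…StrictSplittingRuleSplit.lean`) cuts the crux
into `G` (close-packing certificate, polytype-free) and `F` (`stub_polytypePerturbative`: at `a/100`-hcp sites slack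
`≥ 0` and full strictness, at `a/100`-c-type sites slack `≥ c₁ > 0`).  This file is the VOCABULARY and the sorry-free
STRUCTURAL REDUCTION of `F` to its analytic core, the three-class analogue of the landed two-class reduction
`perturbative_certificate_of_core` (`…PerturbativeReduction.lean`, S2b ⇐ `PerturbativeCore`):

* `ctarget a t` — the stretched c-type (cuboctahedral) shell `C(a,t) = a·(fccKissingPattern stretched by 1+t along
  (1,1,1))`, literally the expression inlined in `F`; `CpShell a t η₀ S` — the recentred shell `S` is `η₀`-close to
  `S(a,t)` OR to `C(a,t)` ("close-packed");
* `classRule P a Φ₀` — the composite rule over an inner rule `Φ₀` for an ARBITRARY class `P` of good shells read off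
  the joint pattern (both endpoints in `P` or both outside: `Φ₀`; good–bad bond: the good end takes weight `0` on an
  attractive bond and `1` on a repulsive one), `classSum P a R Φ₀ x k` — the `Φ₀`-weighted energy of the bonds from `k`
  to its `P`-neighbours; `isRule_classRule`, `classSum_le_siteE` (bad neighbours only help a good site) — the generic
  form of `perturbative_isRule` / `perturbative_siteE_ge`;
* `cpGoodSum a t η₀ R Φ₀ x k := classSum (CpShell a t η₀) a R Φ₀ x k` and the core hypothesis
  `PolytypeCore δ a t η₀ e` — for all radii `R ≥ R₀` an inner rule `Φ₀` and `c₁ > 0` with: at hcp-good sites the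
  close-packed-neighbour sum is `≥ e`, at c-good sites `≥ e + c₁`, and at hcp-good sites `< e + c(η)` only for
  `η`-close shells; registered anchor `stub_polytypeCoreMono` (antitone in the threshold `e`);
* `polytype_certificate_of_core : 0 < δ → eInf ≤ e → PolytypeCore δ a t η₀ e → F(δ,a,t,η₀)` and
  `polytypePerturbative_of_core`: the REGISTERED signature of `stub_polytypePerturbative` VERBATIM from the core at
  `e = e(hcp(a,h))`, `η₀ = a/100` (`eInf ≤ e(hcp(a,h))` is the landed `PeriodicUpperBound`).

Why a three-class reduction and not S2b plus a dump class: on an hcp–c bond the S2b composite rule hands the whole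
attractive bond to the c-end (`3` such bonds per c-site of a deformation fault, `≈ 0.12` of deficit against a budget
`c₁ ≲ |J₂| ≈ 7.3·10⁻⁵`), so c-type sites cannot be a deficit class: the inner rule must treat hcp–hcp, hcp–c and c–c
bonds alike and the core must be a JOINT statement about `≤ 1 %`-strained, possibly faulted, close-packed environments.
Line-internal bookkeeping definitions and elementary lemmas ([folklore]); nothing here closes an item.
-/

noncomputable section

namespace Summit.AtomisticToContinuum.Crystallization.Theorems.StrictSplittingRuleBirth

open scoped BigOperators Classical
open Literature.MathematicalPhysics.StatisticalMechanics
open Literature.Geometry.DiscreteGeometry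

/-- Euclidean `3`-space. -/
local notation "E3" => EuclideanSpace ℝ (Fin 3)

/-! ## §1  The c-type target and close-packed shells -/

/-- The stretched c-type (cuboctahedral) shell `C(a,t) = a·(fccKissingPattern stretched by 1+t along (1,1,1))`
(`fccKissingPattern` and `hcpKissingPattern` share the hexagonal plane `x + y + z = 0`, so the stretch map of `target`
applies verbatim); definitionally the expression inlined in `stub_polytypePerturbative`. [folklore] -/
def ctarget (a t : ℝ) : Finset E3 :=
  fccKissingPattern.image fun u => a • (u + (t * (u 0 + u 1 + u 2) / 3) • intVec ![1, 1, 1])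

/-- A recentred shell `S` is CLOSE-PACKED at tolerance `η₀`: `η₀`-close (up to `O(3)`) to the stretched hcp shell
`S(a,t)` or to the stretched c-type shell `C(a,t)`. [folklore] -/
def CpShell (a t η₀ : ℝ) (S : Finset E3) : Prop :=
  ShellCloseTo η₀ S (target a t) ∨ ShellCloseTo η₀ S (ctarget a t)

/-! ## §2  The composite rule over an arbitrary class of good shells -/

/-- **The class rule** over an inner rule `Φ₀` and a class `P` of good (recentred) shells, read off the joint pattern
`T` of the bond `v` (`patternShell a T 0` is the shell of the near end, `patternShell a T v` that of the far end): both
ends good or both bad — `Φ₀`; good–bad bond — the good end takes weight `0` if the bond is attractive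
(`V_LJ(|v|) ≤ 0`) and `1` if repulsive.  `compositeRule a t η₀` of the Defs file is the case `P = (· is η₀-close to
S(a,t))`. [folklore] -/
def classRule (P : Finset E3 → Prop) (a : ℝ) (Φ₀ : E3 → Finset E3 → ℝ) : E3 → Finset E3 → ℝ := fun v T =>
  if P (patternShell a T 0) then
    (if P (patternShell a T v) then Φ₀ v T else if lennardJones ‖v‖ ≤ 0 then 0 else 1)
  else
    (if P (patternShell a T v) then (if lennardJones ‖v‖ ≤ 0 then 1 else 0) else Φ₀ v T)

/-- The `P`-NEIGHBOUR part of the weighted site energy of `k` under the inner rule `Φ₀`: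
`∑_{j ≠ k, shell of j in P} Φ₀(x_j − x_k, T_kj) · V_LJ(r_kj)`. [folklore] -/
def classSum (P : Finset E3 → Prop) (a R : ℝ) (Φ₀ : E3 → Finset E3 → ℝ) {N : ℕ} (x : Fin N → E3)
    (k : Fin N) : ℝ :=
  ∑ j ∈ (Finset.univ.erase k).filter (fun j => P (shell a x j)),
    Φ₀ (x j - x k) (bondPattern R x k j) * lennardJones (dist (x k) (x j))

/-- **The class rule is a rule** (box + complementarity) whenever the inner rule is: the swap `v ↦ −v`,
`T ↦ T − v` exchanges the two endpoint shells and preserves `|v|`. [folklore] -/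
theorem isRule_classRule (P : Finset E3 → Prop) (a : ℝ) {Φ₀ : E3 → Finset E3 → ℝ} (h₀ : IsRule Φ₀) :
    IsRule (classRule P a Φ₀) := by
  refine ⟨fun v T => ?_, fun v T hv => ?_⟩
  · obtain ⟨hlo, hhi⟩ := h₀.1 v T
    unfold classRule
    split_ifs <;> first | exact ⟨hlo, hhi⟩ | exact ⟨le_rfl, zero_le_one⟩ | exact ⟨zero_le_one, le_rfl⟩
  · have hc := h₀.2 v T hv
    have e0 : P (patternShell a (T.image fun u => u - v) 0) ↔ P (patternShell a T v) := by
      rw [perturbative_patternShell_shift_zero]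
    have e1 : P (patternShell a (T.image fun u => u - v) (-v)) ↔ P (patternShell a T 0) := by
      rw [perturbative_patternShell_shift_neg]
    by_cases g0 : P (patternShell a T 0) <;> by_cases gv : P (patternShell a T v) <;>
      by_cases hs : lennardJones ‖v‖ ≤ 0 <;>
      simp only [classRule, e0, e1, g0, gv, hs, norm_neg, if_true, if_false] <;>
      linarith

/-- **Bad neighbours only help a good site.**  At a site `k` whose shell is in the class `P` (radius `R ≥ 5a/4`,
injective configuration) the class rule's weighted site energy is at least the `P`-neighbour part under `Φ₀`: bonds to
sites outside the class contribute `0` (attractive) or `V > 0` (repulsive, weight `1`). [folklore] -/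
theorem classSum_le_siteE (P : Finset E3 → Prop) {N : ℕ} {x : Fin N → E3} (hx : Function.Injective x) {a R : ℝ}
    (haR : 5 * a / 4 ≤ R) (Φ₀ : E3 → Finset E3 → ℝ) {k : Fin N} (hk : P (shell a x k)) :
    classSum P a R Φ₀ x k ≤ siteE R (classRule P a Φ₀) x k := by
  rw [perturbative_siteE_eq, classSum,
    ← Finset.sum_filter_add_sum_filter_not (Finset.univ.erase k) (fun j => P (shell a x j))]
  have hsplit : ∀ j : Fin N, classRule P a Φ₀ (x j - x k) (bondPattern R x k j) =
      if P (shell a x j) then Φ₀ (x j - x k) (bondPattern R x k j)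
      else if lennardJones ‖x j - x k‖ ≤ 0 then 0 else 1 := by
    intro j
    have g0 : P (patternShell a (bondPattern R x k j) 0) := by
      rw [perturbative_patternShell_realised_zero hx haR]; exact hk
    have gv : P (patternShell a (bondPattern R x k j) (x j - x k)) ↔ P (shell a x j) := by
      rw [perturbative_patternShell_realised_far hx haR]
    unfold classRule
    rw [if_pos g0]
    simp only [gv]
  refine le_add_of_le_of_nonneg (le_of_eq (Finset.sum_congr rfl fun j hj => ?_))
    (Finset.sum_nonneg fun j hj => ?_)
  · rw [Finset.mem_filter] at hj
    rw [hsplit j, if_pos hj.2]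
  · rw [Finset.mem_filter] at hj
    rw [hsplit j, if_neg hj.2, ← dist_eq_norm, dist_comm]
    split_ifs with hs
    · rw [zero_mul]
    · rw [one_mul]
      exact (not_le.mp hs).le

/-! ## §3  The close-packed-neighbour sum and the core of `F` -/

/-- The CLOSE-PACKED-NEIGHBOUR part of the weighted site energy of `k` under the inner rule `Φ₀` (neighbours whose
shell is `η₀`-close to `S(a,t)` or to `C(a,t)`). [folklore] -/
def cpGoodSum (a t η₀ R : ℝ) (Φ₀ : E3 → Finset E3 → ℝ) {N : ℕ} (x : Fin N → E3) (k : Fin N) : ℝ :=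
  classSum (CpShell a t η₀) a R Φ₀ x k

/-- **`PolytypeCore δ a t η₀ e`** — the analytic content of `F` (`stub_polytypePerturbative`), isolated: for all
radii `R ≥ R₀` some inner rule `Φ₀` and some `c₁ > 0` make, at every site `k` of every `δ`-separated configuration,
the `Φ₀`-weighted energy of the bonds from `k` to its CLOSE-PACKED neighbours (i) `≥ e` if the shell of `k` is
`η₀`-close to `S(a,t)`, (ii) `≥ e + c₁` if it is `η₀`-close to `C(a,t)`, and (iii) `< e + c(η)` at an hcp-good site
only if its shell is `η`-close to `S(a,t)`.  Intended threshold `e = e(hcp(a,h))` at the family minimiser (then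
`e_∞ ≤ e` is `PeriodicUpperBound`): sitewise zeroth-, first- and second-order bookkeeping of Lennard-Jones lattice
sums over `≤ 1 %`-strained, possibly FAULTED, close-packed environments (the c-type budget is the registry coupling
`|J₂|`).  A line-internal proof obligation, not a cited fact. [folklore] -/
def PolytypeCore (δ a t η₀ e : ℝ) : Prop :=
  ∃ R₀ : ℝ, ∀ R : ℝ, R₀ ≤ R → ∃ (Φ₀ : E3 → Finset E3 → ℝ) (c₁ : ℝ), IsRule Φ₀ ∧ 0 < c₁ ∧
    (∀ (N : ℕ) (x : Fin N → E3), Sep δ x → ∀ k : Fin N,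
        ShellCloseTo η₀ (shell a x k) (target a t) → e ≤ cpGoodSum a t η₀ R Φ₀ x k) ∧
    (∀ (N : ℕ) (x : Fin N → E3), Sep δ x → ∀ k : Fin N,
        ShellCloseTo η₀ (shell a x k) (ctarget a t) → e + c₁ ≤ cpGoodSum a t η₀ R Φ₀ x k) ∧
    ∀ η : ℝ, 0 < η → ∃ c : ℝ, 0 < c ∧ ∀ (N : ℕ) (x : Fin N → E3), Sep δ x → ∀ k : Fin N,
      ShellCloseTo η₀ (shell a x k) (target a t) → cpGoodSum a t η₀ R Φ₀ x k < e + c →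
        ShellCloseTo η (shell a x k) (target a t)

/-- Registered anchor `stub_polytypeCoreMono` of line `polytype`: the core is ANTITONE in its threshold —
lowering `e` to `e' ≤ e` keeps it (same radius, rule and `c₁`).  Used with `e' = e_∞ ≤ e = e(hcp(a,h))`; its
landing puts this vocabulary in the tree. [folklore] -/
theorem stub_polytypeCoreMono : ∀ δ a t η₀ e e' : ℝ, e' ≤ e →
    PolytypeCore δ a t η₀ e → PolytypeCore δ a t η₀ e' := by
  rintro δ a t η₀ e e' hle ⟨R₀, hR₀⟩
  refine ⟨R₀, fun R hR => ?_⟩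
  obtain ⟨Φ₀, c₁, hrule, hc₁, hH, hC, hstrict⟩ := hR₀ R hR
  refine ⟨Φ₀, c₁, hrule, hc₁, fun N x hx k hk => hle.trans (hH N x hx k hk),
    fun N x hx k hk => le_trans (by linarith) (hC N x hx k hk), fun η hη => ?_⟩
  obtain ⟨c, hc, hstr⟩ := hstrict η hη
  exact ⟨c, hc, fun N x hx k hk hlt => hstr N x hx k hk (lt_of_lt_of_le hlt (by linarith))⟩

/-! ## §4  The reduction of `F` to the core -/

/-- **`F` from the core at any threshold `e ≥ e_∞`**: the class rule for the close-packed class built on the core's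
`Φ₀` (radius `max R₀ (5a/4)`) has slack `≥ 0` at hcp-good sites, `≥ c₁` at c-good sites, and is strict at hcp-good
sites. [folklore] -/
theorem polytype_certificate_of_core {δ a t η₀ e : ℝ} (hδ : 0 < δ) (he : eInf ≤ e)
    (hcore : PolytypeCore δ a t η₀ e) :
    ∃ R₀ : ℝ, ∀ R : ℝ, R₀ ≤ R → ∃ (Φ : E3 → Finset E3 → ℝ) (c₁ : ℝ), IsRule Φ ∧ 0 < c₁ ∧
      (∀ (N : ℕ) (x : Fin N → E3), Sep δ x → ∀ k : Fin N,
          ShellCloseTo η₀ (shell a x k) (target a t) → eInf ≤ siteE R Φ x k) ∧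
      (∀ (N : ℕ) (x : Fin N → E3), Sep δ x → ∀ k : Fin N,
          ShellCloseTo η₀ (shell a x k) (ctarget a t) → eInf + c₁ ≤ siteE R Φ x k) ∧
      ∀ η : ℝ, 0 < η → ∃ c : ℝ, 0 < c ∧ ∀ (N : ℕ) (x : Fin N → E3), Sep δ x → ∀ k : Fin N,
        ShellCloseTo η₀ (shell a x k) (target a t) → siteE R Φ x k < eInf + c →
          ShellCloseTo η (shell a x k) (target a t) := by
  obtain ⟨R₀, hR₀⟩ := hcore
  refine ⟨max R₀ (5 * a / 4), fun R hR => ?_⟩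
  obtain ⟨Φ₀, c₁, hrule, hc₁, hH, hC, hstrict⟩ := hR₀ R ((le_max_left _ _).trans hR)
  have haR : 5 * a / 4 ≤ R := (le_max_right _ _).trans hR
  refine ⟨classRule (CpShell a t η₀) a Φ₀, c₁, isRule_classRule _ a hrule, hc₁, fun N x hx k hk => ?_,
    fun N x hx k hk => ?_, fun η hη => ?_⟩
  · exact (he.trans (hH N x hx k hk)).trans
      (classSum_le_siteE (CpShell a t η₀) (perturbative_injective_of_sep hδ hx) haR Φ₀ (Or.inl hk))
  · have h1 := hC N x hx k hk
    have h2 : cpGoodSum a t η₀ R Φ₀ x k ≤ siteE R (classRule (CpShell a t η₀) a Φ₀) x k :=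
      classSum_le_siteE (CpShell a t η₀) (perturbative_injective_of_sep hδ hx) haR Φ₀ (Or.inr hk)
    linarith
  · obtain ⟨c, hc, hstr⟩ := hstrict η hη
    refine ⟨c, hc, fun N x hx k hk hlt => hstr N x hx k hk ?_⟩
    have h1 := classSum_le_siteE (CpShell a t η₀) (perturbative_injective_of_sep hδ hx) haR Φ₀ (Or.inl hk)
    have h2 : cpGoodSum a t η₀ R Φ₀ x k ≤ siteE R (classRule (CpShell a t η₀) a Φ₀) x k := h1
    linarith

/-- **The registered signature of `F` (`stub_polytypePerturbative`), VERBATIM, from the core at `e = e(hcp(a,h))`,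
`η₀ = a/100`** (then `e_∞ ≤ e(hcp(a,h))` is the landed `PeriodicUpperBound`).  This is the exact remaining
obligation of line `polytype`. [folklore] -/
theorem polytypePerturbative_of_core
    (hcore : ∀ δ : ℝ, 0 < δ → ∀ a h t : ℝ, 0 < a → |t| ≤ 1 / 100 →
      h = (1 + t) * a * Real.sqrt (2 / 3) → HcpFamilyMin a h → ∀ (ha : a ≠ 0) (hh : h ≠ 0),
        PolytypeCore δ a t (a / 100) ((hcpPeriodicConfiguration ha hh).energyPerParticle lennardJones)) :
    ∀ δ : ℝ, 0 < δ → ∀ a h t : ℝ, 0 < a → |t| ≤ 1 / 100 → h = (1 + t) * a * Real.sqrt (2 / 3) →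
      HcpFamilyMin a h → ∃ R₀ : ℝ, ∀ R : ℝ, R₀ ≤ R →
        ∃ (Φ : (EuclideanSpace ℝ (Fin 3)) → Finset (EuclideanSpace ℝ (Fin 3)) → ℝ) (c₁ : ℝ), IsRule Φ ∧ 0 < c₁ ∧
          (∀ (N : ℕ) (x : Fin N → (EuclideanSpace ℝ (Fin 3))), Sep δ x → ∀ k : Fin N,
              ShellCloseTo (a / 100) (shell a x k) (target a t) → eInf ≤ siteE R Φ x k) ∧
          (∀ (N : ℕ) (x : Fin N → (EuclideanSpace ℝ (Fin 3))), Sep δ x → ∀ k : Fin N,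
              ShellCloseTo (a / 100) (shell a x k)
                (fccKissingPattern.image fun u => a • (u + (t * (u 0 + u 1 + u 2) / 3) • intVec ![1, 1, 1])) →
                eInf + c₁ ≤ siteE R Φ x k) ∧
          ∀ η : ℝ, 0 < η → ∃ c : ℝ, 0 < c ∧ ∀ (N : ℕ) (x : Fin N → (EuclideanSpace ℝ (Fin 3))), Sep δ x →
            ∀ k : Fin N, ShellCloseTo (a / 100) (shell a x k) (target a t) → siteE R Φ x k < eInf + c →
              ShellCloseTo η (shell a x k) (target a t) := by
  intro δ hδ a h t ha ht hht hmin
  obtain ⟨ha', hh', hmin'⟩ := hmin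
  have hP := periodicUpperBound_proof
  unfold Summit.AtomisticToContinuum.Crystallization.Theses.FreeSplittingCertificates.PeriodicUpperBound at hP
  exact polytype_certificate_of_core hδ (hP _) (hcore δ hδ a h t ha ht hht ⟨ha', hh', hmin'⟩ ha' hh')

end Summit.AtomisticToContinuum.Crystallization.Theorems.StrictSplittingRuleBirth

end
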